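import Literature.MathematicalPhysics.KineticTheory.PureQuarticEnergy
import HarnessLib

/-!
# The purely quartic chain driven by a continuous noise path: pathwise (strong) solutions

Topic `Literature/MathematicalPhysics/KineticTheory`. Second layer of the proof of the named fact
`CuneoEckmannHairerReyBellet2018_thm213_pureQuartic` (`PureQuarticChainNESS.lean`; CEHR 2018 =
Cuneo–Eckmann–Hairer–Rey-Bellet, EJP 23 (2018) no. 55, Thm 2.13, for
`pureQuarticChain μ γ = ⟨μq⁴/4, r⁴/4, γ⟩`): the deterministic layer of the construction of the
transition semigroup of the SDE (2.2), i.e. `LangevinChainSDE.lean` (written for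
`pinnedChain ω₂ lam β γ`) RE-INSTANTIATED VERBATIM for the purely quartic chain (`μ > 0`, `γ ≥ 0`).
The generic objects (`truncateField`, `OscillatorChain.forcing/truncSol/chainFlow`, the integral
equation (IE) `z(t) = x + (0, η(t)) + ∫₀ᵗ Y(z(s)) ds`) are those of `LangevinChainSDE.lean`; the
chain-specific input is the linear energy bound and the coercivity of `PureQuarticEnergy.lean`.

* `pureQuarticChain_hamiltonian_truncSol_le` — the a-priori energy bound
  `1 + H(z(t) - (0,η(t))) ≤ (1 + H(x)) e^{C M t}` (Grönwall), whence the a-priori radius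
  `pureQuarticRadius` with `‖z(t)‖ ≤ R₀(T, H(x), M)` on `[0, T]`, uniform in the truncation;
* `OscillatorChain.chainFlow (pureQuarticChain μ γ) N x η t` solves (IE) on every `[0, T]`
  (`pureQuarticChain_isIntegralSolutionOn_chainFlow`), is the unique continuous solution
  (`pureQuarticChain_eqOn_chainFlow`), is continuous in `t`, depends on `η` only through
  `η|[0,T]`, satisfies the cocycle identity (`pureQuarticChain_chainFlow_add`), is continuous in
  the initial condition (`pureQuarticChain_continuous_chainFlow_left`) and measurable.

## References

* N. Cuneo, J.-P. Eckmann, M. Hairer, L. Rey-Bellet, EJP 23 (2018) no. 55, §2 (2.2), §3 p. 7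
  ("the process admits strong solutions that are continuous and defined for all `t ≥ 0`").
* R. Khasminskii, *Stochastic Stability of Differential Equations* (2nd ed., 2012), Thm 3.5.
-/

noncomputable section

open MeasureTheory Filter Topology Set Metric
open scoped NNReal ContDiff

namespace Literature.MathematicalPhysics.KineticTheory.HeatConduction

section PureQuarticFlow

variable {μ γ : ℝ}

open OscillatorChain

/-- The truncated drift of the purely quartic chain is globally Lipschitz (some constant). [folklore] -/
theorem pureQuarticChain_exists_lipschitzWith_truncDrift (μ γ : ℝ) (N : ℕ) {R : ℝ} (hR : 0 < R) :
    ∃ K : ℝ≥0, LipschitzWith K (truncateField R ((pureQuarticChain μ γ).drift N)) :=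
  exists_lipschitzWith_truncateField (pureQuarticChain_contDiff_drift μ γ N) hR

/-- **The a-priori energy bound** (non-explosion estimate) for the truncated dynamics of the
purely quartic chain (`μ > 0`, `γ ≥ 0`), uniform in the truncation radius `R > 0`: if
`‖η‖ ≤ M` on `[0, T]` then the solution `z = truncSol R x η` satisfies
`1 + H(z(t) - (0, η(t))) ≤ (1 + H(x)) e^{C M t}` on `[0, T]`, `C = pureQuarticEnergyConst`
(Grönwall for `h(t) = H(y(t))`, `y = z - (0,η)`, `y' = Y_R(z)`,
`h' = χ_R DH(y)·Y(y + (0,η)) ≤ C ‖η‖ (1 + h)`). This replaces the Itô/Lyapunov non-explosion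
argument of CEHR p. 7 / Khasminskii Thm 3.5 by a pathwise one (possible because the noise is
additive). [cite: CuneoEckmannHairerReyBellet2018, §3 p. 7] -/
theorem pureQuarticChain_hamiltonian_truncSol_le (hμ : 0 < μ) (hγ : 0 ≤ γ)
    (N : ℕ) {R : ℝ} (hR : 0 < R) (x : PhaseSpace N) {η : ℝ → Fin N → ℝ} (hη : Continuous η)
    {T M : ℝ} (hM : ∀ t ∈ Icc 0 T, ‖η t‖ ≤ M) :
    ∀ t ∈ Icc 0 T, 1 + (pureQuarticChain μ γ).hamiltonian N
        ((pureQuarticChain μ γ).truncSol N R x η t - ((0 : Fin N → ℝ), η t)) ≤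
      (1 + (pureQuarticChain μ γ).hamiltonian N x) *
        Real.exp (pureQuarticEnergyConst μ γ N * M * t) := by
  intro t ht
  set P := pureQuarticChain μ γ with hP
  set H := P.hamiltonian N with hHdef
  set Y := P.drift N with hYdef
  set YR := truncateField R Y with hYRdef
  set g := forcing x η with hgdef
  set z := P.truncSol N R x η with hzdef
  set C := pureQuarticEnergyConst μ γ N with hCdef
  have hT : 0 ≤ T := ht.1.trans ht.2
  have hM0 : 0 ≤ M := (norm_nonneg _).trans (hM 0 ⟨le_rfl, hT⟩)
  have hC0 : 0 ≤ C := pureQuarticEnergyConst_nonneg hμ γ N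
  obtain ⟨K, hK⟩ := pureQuarticChain_exists_lipschitzWith_truncDrift μ γ N hR
  have hYc : Continuous Y := (pureQuarticChain_contDiff_drift μ γ N (n := 0)).continuous
  have hYRc : Continuous YR := continuous_truncateField R hYc
  have hg : Continuous g := continuous_forcing x hη
  have hz_eq : ∀ s, 0 ≤ s → z s = g s + ∫ r in (0 : ℝ)..s, YR (z r) := fun s hs =>
    Literature.Analysis.ODE.forcedSolution_eq hK hg hs
  have hzc : Continuous z := Literature.Analysis.ODE.continuous_forcedSolution hK hg
  have hHs : ContDiff ℝ 1 H := pureQuarticChain_contDiff_hamiltonian μ γ N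
  have hHd : Differentiable ℝ H := hHs.differentiable one_ne_zero
  -- `y(t) = x + ∫₀ᵗ Y_R(z)`, `y' = Y_R(z)`, `y = z - (0, η)` on `[0, ∞)`
  set y : ℝ → PhaseSpace N := fun s => x + ∫ r in (0 : ℝ)..s, YR (z r) with hydef
  have hy_deriv : ∀ s, HasDerivAt y (YR (z s)) s := fun s => by
    have h1 : HasDerivAt (fun u => ∫ r in (0 : ℝ)..u, YR (z r)) (YR (z s)) s :=
      ((hYRc.comp hzc).integral_hasStrictDerivAt 0 s).hasDerivAt
    exact h1.const_add x
  have hy_eq : ∀ s, 0 ≤ s → y s = z s - ((0 : Fin N → ℝ), η s) := fun s hs => by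
    rw [hz_eq s hs]
    simp only [hydef, hgdef, forcing]
    abel
  have hz_y : ∀ s, 0 ≤ s → z s = ((y s).1, (y s).2 + η s) := fun s hs => by
    rw [hy_eq s hs]; ext i <;> simp
  -- the energy along `y`
  set h : ℝ → ℝ := fun s => H (y s) with hhdef
  have hh_deriv : ∀ s, HasDerivAt h (fderiv ℝ H (y s) (YR (z s))) s := fun s =>
    (hHd (y s)).hasFDerivAt.comp_hasDerivAt s (hy_deriv s)
  have hh_cont : Continuous h := continuous_iff_continuousAt.2 fun s => (hh_deriv s).continuousAt
  have hbound : ∀ s ∈ Ico 0 T, fderiv ℝ H (y s) (YR (z s)) ≤ C * M * h s + C * M := by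
    intro s hs
    have hB : fderiv ℝ H (y s) (Y (z s)) ≤ C * M * (1 + h s) := by
      rw [hz_y s hs.1]
      refine (P.fderiv_hamiltonian_drift_le hHd hγ (y s) (η s)).trans ?_
      have hL := pureQuarticChain_linearEnergyBound hμ hγ N (y s)
      have hηs : ‖η s‖ ≤ M := hM s ⟨hs.1, hs.2.le⟩
      have hLnn : 0 ≤ (∑ i, |partialQ i (P.hamiltonian N) (y s)|) + 2 * γ * ∑ i, |(y s).2 i| := by
        have : 0 ≤ ∑ i, |(y s).2 i| := Finset.sum_nonneg fun i _ => abs_nonneg _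
        have : 0 ≤ ∑ i, |partialQ i (P.hamiltonian N) (y s)| :=
          Finset.sum_nonneg fun i _ => abs_nonneg _
        positivity
      calc ‖η s‖ * ((∑ i, |partialQ i (P.hamiltonian N) (y s)|) + 2 * P.γ * ∑ i, |(y s).2 i|)
          ≤ M * (C * (1 + H (y s))) := mul_le_mul hηs hL hLnn hM0
        _ = C * M * (1 + h s) := by ring
    have hc0 := radialCutoff_nonneg R (z s)
    have hc1 := radialCutoff_le_one R (z s)
    have hpos : 0 ≤ C * M * (1 + h s) := by
      have : 0 ≤ h s := pureQuarticChain_hamiltonian_nonneg hμ.le γ N (y s)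
      positivity
    calc fderiv ℝ H (y s) (YR (z s)) = radialCutoff R (z s) * fderiv ℝ H (y s) (Y (z s)) := by
          rw [hYRdef, truncateField, map_smul, smul_eq_mul]
      _ ≤ radialCutoff R (z s) * (C * M * (1 + h s)) := mul_le_mul_of_nonneg_left hB hc0
      _ ≤ 1 * (C * M * (1 + h s)) := mul_le_mul_of_nonneg_right hc1 hpos
      _ = C * M * h s + C * M := by ring
  -- Grönwall
  have hG := le_gronwallBound_of_liminf_deriv_right_le (f := h)
    (f' := fun s => fderiv ℝ H (y s) (YR (z s))) (δ := H x) (K := C * M) (ε := C * M) (a := 0)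
    (b := T) hh_cont.continuousOn (fun s _ r hr => ?_) (by simp [hhdef, hydef]) hbound t ht
  · rw [sub_zero] at hG
    have hfin : h t = H (z t - ((0 : Fin N → ℝ), η t)) := by
      show H (y t) = _
      rw [hy_eq t ht.1]
    rw [← hfin]
    rcases (mul_nonneg hC0 hM0).eq_or_lt with hK0 | hKpos
    · rw [← hK0, gronwallBound_K0] at hG
      rw [← hK0]
      simp only [zero_mul, add_zero] at hG
      simpa using hG
    · rw [gronwallBound_of_K_ne_0 hKpos.ne'] at hG
      simp only [div_self hKpos.ne', one_mul] at hG
      calc 1 + h t ≤ 1 + (H x * Real.exp (C * M * t) + (Real.exp (C * M * t) - 1)) := by linarith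
        _ = (1 + H x) * Real.exp (C * M * t) := by ring
  · have := ((hh_deriv s).hasDerivWithinAt (s := Ici s)).liminf_right_slope_le hr
    refine this.mono fun w hw => ?_
    rwa [slope_def_field, div_eq_inv_mul] at hw

/-- **Truncated solutions stay in the a-priori ball**: `‖truncSol R x η (t)‖ ≤ R₀(H(x), M, T)`
on `[0, T]`, for every truncation radius `R > 0`. [folklore] -/
theorem pureQuarticChain_norm_truncSol_le (hμ : 0 < μ) (hγ : 0 ≤ γ)
    (N : ℕ) {R : ℝ} (hR : 0 < R) (x : PhaseSpace N) {η : ℝ → Fin N → ℝ} (hη : Continuous η)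
    {T M : ℝ} (hM : ∀ t ∈ Icc 0 T, ‖η t‖ ≤ M) :
    ∀ t ∈ Icc 0 T, ‖(pureQuarticChain μ γ).truncSol N R x η t‖ ≤
      pureQuarticRadius μ γ N ((pureQuarticChain μ γ).hamiltonian N x) M T := by
  intro t ht
  set z := (pureQuarticChain μ γ).truncSol N R x η t
  have hT : 0 ≤ T := ht.1.trans ht.2
  have hM0 : 0 ≤ M := (norm_nonneg _).trans (hM 0 ⟨le_rfl, hT⟩)
  have hC0 := pureQuarticEnergyConst_nonneg hμ γ N
  have hE := pureQuarticChain_hamiltonian_truncSol_le hμ hγ N hR x hη hM t ht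
  have hexp : Real.exp (pureQuarticEnergyConst μ γ N * M * t) ≤
      Real.exp (pureQuarticEnergyConst μ γ N * M * T) :=
    Real.exp_le_exp.2 (mul_le_mul_of_nonneg_left ht.2 (mul_nonneg hC0 hM0))
  have hH0 := pureQuarticChain_hamiltonian_nonneg hμ.le γ N x
  have hy : ‖z - ((0 : Fin N → ℝ), η t)‖ ≤ pureQuarticSublevelRadius μ
      ((1 + (pureQuarticChain μ γ).hamiltonian N x) *
        Real.exp (pureQuarticEnergyConst μ γ N * M * T) - 1) := by
    refine pureQuarticChain_norm_le_sublevelRadius hμ γ N ?_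
    nlinarith
  have hn : ‖((0 : Fin N → ℝ), η t)‖ ≤ M := by
    rw [Prod.norm_def]; simp [hM t ht]
  calc ‖z‖ = ‖(z - ((0 : Fin N → ℝ), η t)) + ((0 : Fin N → ℝ), η t)‖ := by rw [sub_add_cancel]
    _ ≤ ‖z - ((0 : Fin N → ℝ), η t)‖ + ‖((0 : Fin N → ℝ), η t)‖ := norm_add_le _ _
    _ ≤ _ := add_le_add hy hn

/-- **Beyond the a-priori radius the truncation is invisible**: if `R₀(H(x), M, T) ≤ R` then
`truncSol R x η` solves the UNtruncated equation (IE) on `[0, T]`. [folklore] -/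
theorem pureQuarticChain_isIntegralSolutionOn_truncSol (hμ : 0 < μ)
    (hγ : 0 ≤ γ) (N : ℕ) {R : ℝ} (hR : 0 < R) (x : PhaseSpace N) {η : ℝ → Fin N → ℝ}
    (hη : Continuous η) {T M : ℝ} (hM : ∀ t ∈ Icc 0 T, ‖η t‖ ≤ M)
    (hRR : pureQuarticRadius μ γ N ((pureQuarticChain μ γ).hamiltonian N x) M T ≤ R) :
    Literature.Analysis.ODE.IsIntegralSolutionOn ((pureQuarticChain μ γ).drift N) (forcing x η)
      ((pureQuarticChain μ γ).truncSol N R x η) T := by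
  intro t ht
  obtain ⟨K, hK⟩ := pureQuarticChain_exists_lipschitzWith_truncDrift μ γ N hR
  have h := Literature.Analysis.ODE.forcedSolution_eq hK (continuous_forcing x hη) ht.1
  unfold OscillatorChain.truncSol
  rw [h]
  congr 1
  refine intervalIntegral.integral_congr fun s hs => ?_
  rw [uIcc_of_le ht.1] at hs
  exact truncateField_of_norm_le hR _
    ((pureQuarticChain_norm_truncSol_le hμ hγ N hR x hη hM s ⟨hs.1, hs.2.trans ht.2⟩).trans hRR)

/-- **Uniqueness for the untruncated equation**: two continuous solutions of (IE) (purely quartic chain,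
same forcing) coincide on `[0, T]` — both are bounded there and the smooth drift is Lipschitz on
bounded sets. [folklore] -/
theorem pureQuarticChain_eqOn_of_isIntegralSolutionOn (μ γ : ℝ) (N : ℕ) {g z₁ z₂ : ℝ → PhaseSpace N}
    {T : ℝ} (h₁ : Literature.Analysis.ODE.IsIntegralSolutionOn ((pureQuarticChain μ γ).drift N) g z₁ T)
    (h₂ : Literature.Analysis.ODE.IsIntegralSolutionOn ((pureQuarticChain μ γ).drift N) g z₂ T) (hc₁ : Continuous z₁)
    (hc₂ : Continuous z₂) : EqOn z₁ z₂ (Icc 0 T) := by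
  obtain ⟨B₁, hB₁⟩ := isCompact_Icc.exists_bound_of_continuousOn (hc₁.continuousOn (s := Icc 0 T))
  obtain ⟨B₂, hB₂⟩ := isCompact_Icc.exists_bound_of_continuousOn (hc₂.continuousOn (s := Icc 0 T))
  obtain ⟨K, hK⟩ := exists_lipschitzOnWith_closedBall
    (pureQuarticChain_contDiff_drift μ γ N (n := 1)) (max B₁ B₂)
  refine h₁.eqOn_of_lipschitzOnWith hK h₂ hc₁ hc₂ (fun t ht => ?_) fun t ht => ?_
  · rw [mem_closedBall, dist_zero_right]; exact (hB₁ t ht).trans (le_max_left _ _)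
  · rw [mem_closedBall, dist_zero_right]; exact (hB₂ t ht).trans (le_max_right _ _)

/-- Truncated solutions with radii beyond the a-priori radius agree on `[0, T]`. [folklore] -/
theorem pureQuarticChain_truncSol_eqOn (hμ : 0 < μ) (hγ : 0 ≤ γ) (N : ℕ)
    {R R' : ℝ} (hR : 0 < R) (hR' : 0 < R') (x : PhaseSpace N) {η : ℝ → Fin N → ℝ}
    (hη : Continuous η) {T M : ℝ} (hM : ∀ t ∈ Icc 0 T, ‖η t‖ ≤ M)
    (hRR : pureQuarticRadius μ γ N ((pureQuarticChain μ γ).hamiltonian N x) M T ≤ R)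
    (hRR' : pureQuarticRadius μ γ N ((pureQuarticChain μ γ).hamiltonian N x) M T ≤ R') :
    EqOn ((pureQuarticChain μ γ).truncSol N R x η) ((pureQuarticChain μ γ).truncSol N R' x η)
      (Icc 0 T) := by
  obtain ⟨K, hK⟩ := pureQuarticChain_exists_lipschitzWith_truncDrift μ γ N hR
  obtain ⟨K', hK'⟩ := pureQuarticChain_exists_lipschitzWith_truncDrift μ γ N hR'
  exact pureQuarticChain_eqOn_of_isIntegralSolutionOn μ γ N
    (pureQuarticChain_isIntegralSolutionOn_truncSol hμ hγ N hR x hη hM hRR)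
    (pureQuarticChain_isIntegralSolutionOn_truncSol hμ hγ N hR' x hη hM hRR')
    (Literature.Analysis.ODE.continuous_forcedSolution hK (continuous_forcing x hη))
    (Literature.Analysis.ODE.continuous_forcedSolution hK' (continuous_forcing x hη))

/-! ### The flow of the purely quartic chain -/

/-- **The flow is the truncated solution for every radius beyond the a-priori radius**
(the defining limit is eventually constant). [folklore] -/
theorem pureQuarticChain_chainFlow_eqOn_truncSol (hμ : 0 < μ) (hγ : 0 ≤ γ)
    (N : ℕ) {R : ℝ} (hR : 0 < R) (x : PhaseSpace N) {η : ℝ → Fin N → ℝ} (hη : Continuous η)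
    {T M : ℝ} (hM : ∀ t ∈ Icc 0 T, ‖η t‖ ≤ M)
    (hRR : pureQuarticRadius μ γ N ((pureQuarticChain μ γ).hamiltonian N x) M T ≤ R) :
    EqOn ((pureQuarticChain μ γ).chainFlow N x η) ((pureQuarticChain μ γ).truncSol N R x η)
      (Icc 0 T) := by
  intro t ht
  unfold OscillatorChain.chainFlow
  refine Filter.Tendsto.limUnder_eq (tendsto_const_nhds.congr' ?_)
  obtain ⟨n₀, hn₀⟩ := exists_nat_ge R
  filter_upwards [eventually_ge_atTop n₀] with n hn
  have hnR : R ≤ (n : ℝ) + 1 := hn₀.trans (by exact_mod_cast Nat.le_succ_of_le hn)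
  exact pureQuarticChain_truncSol_eqOn hμ hγ N hR (by positivity) x hη hM hRR (hRR.trans hnR) ht

/-- For `t ≤ 0` the flow is clamped at its initial value `x + (0, η 0)`. [folklore] -/
theorem pureQuarticChain_chainFlow_of_nonpos (μ γ : ℝ) (N : ℕ) (x : PhaseSpace N)
    {η : ℝ → Fin N → ℝ} (hη : Continuous η) {t : ℝ} (ht : t ≤ 0) :
    (pureQuarticChain μ γ).chainFlow N x η t = x + ((0 : Fin N → ℝ), η 0) := by
  unfold OscillatorChain.chainFlow
  refine Filter.Tendsto.limUnder_eq (tendsto_const_nhds.congr' (Eventually.of_forall fun n => ?_))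
  obtain ⟨K, hK⟩ := pureQuarticChain_exists_lipschitzWith_truncDrift μ γ N
    (by positivity : (0 : ℝ) < n + 1)
  show x + ((0 : Fin N → ℝ), η 0) = (pureQuarticChain μ γ).truncSol N (n + 1) x η t
  unfold OscillatorChain.truncSol
  rw [Literature.Analysis.ODE.forcedSolution_of_nonpos _ _ ht, Literature.Analysis.ODE.forcedSolution_zero hK (continuous_forcing x hη)]
  rfl

/-- **The flow solves the Langevin integral equation (IE)** on every `[0, T]` (purely quartic chain,
`μ > 0`, `γ ≥ 0`, continuous noise path): CEHR's "strong solutions … defined for all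
`t ≥ 0`", pathwise. [cite: CuneoEckmannHairerReyBellet2018, §3 p. 7] -/
theorem pureQuarticChain_isIntegralSolutionOn_chainFlow (hμ : 0 < μ)
    (hγ : 0 ≤ γ) (N : ℕ) (x : PhaseSpace N) {η : ℝ → Fin N → ℝ} (hη : Continuous η) (T : ℝ) :
    Literature.Analysis.ODE.IsIntegralSolutionOn ((pureQuarticChain μ γ).drift N) (forcing x η)
      ((pureQuarticChain μ γ).chainFlow N x η) T := by
  obtain ⟨M, -, hM⟩ := exists_noiseBound hη T
  set R := max (pureQuarticRadius μ γ N ((pureQuarticChain μ γ).hamiltonian N x) M T) 1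
  have hR : 0 < R := lt_max_of_lt_right one_pos
  exact (pureQuarticChain_isIntegralSolutionOn_truncSol hμ hγ N hR x hη hM (le_max_left _ _)).congr
    (pureQuarticChain_chainFlow_eqOn_truncSol hμ hγ N hR x hη hM (le_max_left _ _)).symm

/-- **The flow is continuous in time** (on all of `ℝ`, being clamped on `(-∞, 0]`). [folklore] -/
theorem pureQuarticChain_continuous_chainFlow (hμ : 0 < μ) (hγ : 0 ≤ γ)
    (N : ℕ) (x : PhaseSpace N) {η : ℝ → Fin N → ℝ} (hη : Continuous η) :
    Continuous ((pureQuarticChain μ γ).chainFlow N x η) := by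
  refine continuous_of_continuousOn_Icc_of_eq_max (fun T => ?_) fun t => ?_
  · obtain ⟨M, -, hM⟩ := exists_noiseBound hη T
    set R := max (pureQuarticRadius μ γ N ((pureQuarticChain μ γ).hamiltonian N x) M T) 1
    have hR : 0 < R := lt_max_of_lt_right one_pos
    obtain ⟨K, hK⟩ := pureQuarticChain_exists_lipschitzWith_truncDrift μ γ N hR
    exact ((Literature.Analysis.ODE.continuous_forcedSolution hK (continuous_forcing x hη)).continuousOn).congr
      (pureQuarticChain_chainFlow_eqOn_truncSol hμ hγ N hR x hη hM (le_max_left _ _))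
  · rcases le_total t 0 with ht | ht
    · rw [max_eq_right ht, pureQuarticChain_chainFlow_of_nonpos μ γ N x hη ht,
        pureQuarticChain_chainFlow_of_nonpos μ γ N x hη le_rfl]
    · rw [max_eq_left ht]

/-- **The flow stays in the a-priori ball**: `‖chainFlow x η t‖ ≤ R₀(H(x), M, T)` on `[0, T]`
if `‖η‖ ≤ M` there. [folklore] -/
theorem pureQuarticChain_norm_chainFlow_le (hμ : 0 < μ) (hγ : 0 ≤ γ)
    (N : ℕ) (x : PhaseSpace N) {η : ℝ → Fin N → ℝ} (hη : Continuous η) {T M : ℝ}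
    (hM : ∀ t ∈ Icc 0 T, ‖η t‖ ≤ M) :
    ∀ t ∈ Icc 0 T, ‖(pureQuarticChain μ γ).chainFlow N x η t‖ ≤
      pureQuarticRadius μ γ N ((pureQuarticChain μ γ).hamiltonian N x) M T := by
  intro t ht
  set R := max (pureQuarticRadius μ γ N ((pureQuarticChain μ γ).hamiltonian N x) M T) 1
  have hR : 0 < R := lt_max_of_lt_right one_pos
  rw [pureQuarticChain_chainFlow_eqOn_truncSol hμ hγ N hR x hη hM (le_max_left _ _) ht]
  exact pureQuarticChain_norm_truncSol_le hμ hγ N hR x hη hM t ht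

/-- **Uniqueness**: any continuous solution of (IE) is the flow on `[0, T]`. [folklore] -/
theorem pureQuarticChain_eqOn_chainFlow (hμ : 0 < μ) (hγ : 0 ≤ γ)
    (N : ℕ) (x : PhaseSpace N) {η : ℝ → Fin N → ℝ} (hη : Continuous η) {z : ℝ → PhaseSpace N}
    {T : ℝ} (hz : Literature.Analysis.ODE.IsIntegralSolutionOn ((pureQuarticChain μ γ).drift N) (forcing x η) z T)
    (hzc : Continuous z) : EqOn z ((pureQuarticChain μ γ).chainFlow N x η) (Icc 0 T) :=
  pureQuarticChain_eqOn_of_isIntegralSolutionOn μ γ N hz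
    (pureQuarticChain_isIntegralSolutionOn_chainFlow hμ hγ N x hη T) hzc
    (pureQuarticChain_continuous_chainFlow hμ hγ N x hη)

/-- The flow on `[0, T]` only depends on the noise path on `[0, T]`. [folklore] -/
theorem pureQuarticChain_chainFlow_congr (hμ : 0 < μ) (hγ : 0 ≤ γ)
    (N : ℕ) (x : PhaseSpace N) {η₁ η₂ : ℝ → Fin N → ℝ} (hη₁ : Continuous η₁) (hη₂ : Continuous η₂)
    {T : ℝ} (h : EqOn η₁ η₂ (Icc 0 T)) :
    EqOn ((pureQuarticChain μ γ).chainFlow N x η₁) ((pureQuarticChain μ γ).chainFlow N x η₂)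
      (Icc 0 T) := by
  refine (pureQuarticChain_eqOn_chainFlow hμ hγ N x hη₂ ?_
    (pureQuarticChain_continuous_chainFlow hμ hγ N x hη₁))
  exact (pureQuarticChain_isIntegralSolutionOn_chainFlow hμ hγ N x hη₁ T).congr_forcing
    fun t ht => by simp [forcing, h ht]

/-- **The cocycle (flow) property**: for `s, t ≥ 0`,
`z_{x,η}(s + t) = z_{x',η'}(t)` with `x' = z_{x,η}(s)` and the shifted noise
`η' = η(s + ·) - η(s)`. This is the pathwise identity behind the Markov property of the
transition semigroup. [folklore] -/
theorem pureQuarticChain_chainFlow_add (hμ : 0 < μ) (hγ : 0 ≤ γ) (N : ℕ)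
    (x : PhaseSpace N) {η : ℝ → Fin N → ℝ} (hη : Continuous η) {s t : ℝ} (hs : 0 ≤ s) (ht : 0 ≤ t) :
    (pureQuarticChain μ γ).chainFlow N x η (s + t) =
      (pureQuarticChain μ γ).chainFlow N ((pureQuarticChain μ γ).chainFlow N x η s)
        (fun r => η (s + r) - η s) t := by
  set P := pureQuarticChain μ γ
  have hzc := pureQuarticChain_continuous_chainFlow hμ hγ N x hη
  have hη' : Continuous fun r => η (s + r) - η s := (hη.comp (continuous_const_add s)).sub continuous_const
  have hsol : Literature.Analysis.ODE.IsIntegralSolutionOn (P.drift N) (forcing (P.chainFlow N x η s) fun r => η (s + r) - η s)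
      (fun r => P.chainFlow N x η (s + r)) (s + t - s) := by
    have h1 := (pureQuarticChain_isIntegralSolutionOn_chainFlow hμ hγ N x hη (s + t)).shift
      (((pureQuarticChain_contDiff_drift μ γ N (n := 0)).continuous.comp hzc).continuousOn)
      ⟨hs, le_add_of_nonneg_right ht⟩
    exact h1.congr_forcing fun r _ => add_forcing_sub_forcing x _ η s r
  rw [add_sub_cancel_left] at hsol
  exact pureQuarticChain_eqOn_chainFlow hμ hγ N _ hη' hsol (hzc.comp (continuous_const_add s))
    ⟨ht, le_rfl⟩

/-- The energy is bounded on bounded sets: a bound of `H` on the closed ball `closedBall x₀ 1`.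
[folklore] -/
theorem pureQuarticChain_exists_bound_hamiltonian_closedBall (μ γ : ℝ) (N : ℕ) (x₀ : PhaseSpace N) :
    ∃ E₁, ∀ x ∈ closedBall x₀ 1, (pureQuarticChain μ γ).hamiltonian N x ≤ E₁ := by
  obtain ⟨E₁, hE₁⟩ := (isCompact_closedBall x₀ 1).exists_bound_of_continuousOn
    ((pureQuarticChain_continuous_hamiltonian μ γ N).continuousOn)
  exact ⟨E₁, fun x hx => (Real.le_norm_self _).trans (hE₁ x hx)⟩

/-- **Continuous dependence on the initial condition**: `x ↦ z_{x,η}(t)` is continuous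
(locally Lipschitz, by Grönwall for the common truncated equation). [folklore] -/
theorem pureQuarticChain_continuous_chainFlow_left (hμ : 0 < μ) (hγ : 0 ≤ γ)
    (N : ℕ) {η : ℝ → Fin N → ℝ} (hη : Continuous η) (t : ℝ) :
    Continuous fun x => (pureQuarticChain μ γ).chainFlow N x η t := by
  set P := pureQuarticChain μ γ
  rcases le_or_gt t 0 with ht | ht
  · have : (fun x => P.chainFlow N x η t) = fun x => x + ((0 : Fin N → ℝ), η 0) :=
      funext fun x => pureQuarticChain_chainFlow_of_nonpos μ γ N x hη ht
    rw [this]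
    exact continuous_id.add continuous_const
  refine continuous_iff_continuousAt.2 fun x₀ => ?_
  obtain ⟨M, -, hM⟩ := exists_noiseBound hη t
  obtain ⟨E₁, hE₁⟩ := pureQuarticChain_exists_bound_hamiltonian_closedBall μ γ N x₀
  set R := max (pureQuarticRadius μ γ N E₁ M t) 1 with hRdef
  have hR : 0 < R := lt_max_of_lt_right one_pos
  obtain ⟨K, hK⟩ := pureQuarticChain_exists_lipschitzWith_truncDrift μ γ N hR
  -- on the ball, the flow is the truncated solution with the common radius `R`
  have heq : ∀ x ∈ closedBall x₀ 1, P.chainFlow N x η t = P.truncSol N R x η t := fun x hx =>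
    pureQuarticChain_chainFlow_eqOn_truncSol hμ hγ N hR x hη hM
      ((pureQuarticRadius_mono hμ N (hE₁ x hx)).trans (le_max_left _ _)) ⟨ht.le, le_rfl⟩
  have hev : (fun x => P.chainFlow N x η t) =ᶠ[𝓝 x₀] fun x => P.truncSol N R x η t :=
    Filter.eventuallyEq_of_mem (closedBall_mem_nhds x₀ one_pos) heq
  refine ContinuousAt.congr_of_eventuallyEq ?_ hev
  -- the truncated solution is Lipschitz in the initial condition
  have hlip : ∀ x x' : PhaseSpace N, ‖P.truncSol N R x η t - P.truncSol N R x' η t‖ ≤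
      ‖x - x'‖ * Real.exp (K * t) := fun x x' =>
    Literature.Analysis.ODE.norm_forcedSolution_sub_le hK (continuous_forcing x hη) (continuous_forcing x' hη)
      (fun r _ => by rw [forcing_sub_forcing]) t ⟨ht.le, le_rfl⟩
  rw [Metric.continuousAt_iff]
  intro ε hε
  refine ⟨ε / Real.exp (K * t), by positivity, fun x hx => ?_⟩
  rw [dist_eq_norm] at hx ⊢
  calc ‖P.truncSol N R x η t - P.truncSol N R x₀ η t‖ ≤ ‖x - x₀‖ * Real.exp (K * t) := hlip x x₀
    _ < ε / Real.exp (K * t) * Real.exp (K * t) := by gcongr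
    _ = ε := div_mul_cancel₀ ε (Real.exp_pos _).ne'

/-! ### Measurable dependence on parameters -/

/-- **The flow depends measurably on a measurably parametrised initial condition and noise path**
(each truncated solution does, by `stronglyMeasurable_forcedSolution`, and the flow is their
pointwise — eventually constant — limit). The σ-algebra on the parameter space is an implicit
argument. [folklore] -/
theorem pureQuarticChain_measurable_chainFlow (hμ : 0 < μ) (hγ : 0 ≤ γ)
    (N : ℕ) {Ω : Type*} {mΩ : MeasurableSpace Ω} {X : Ω → PhaseSpace N} (hX : Measurable X)
    {G : Ω → ℝ → Fin N → ℝ} (hGc : ∀ w, Continuous (G w)) (hGm : ∀ t, Measurable fun w => G w t)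
    (t : ℝ) : Measurable fun w => (pureQuarticChain μ γ).chainFlow N (X w) (G w) t := by
  have hn : ∀ n : ℕ, Measurable fun w =>
      (pureQuarticChain μ γ).truncSol N (n + 1) (X w) (G w) t := by
    intro n
    obtain ⟨K, hK⟩ := pureQuarticChain_exists_lipschitzWith_truncDrift μ γ N
      (by positivity : (0 : ℝ) < n + 1)
    have h := Literature.Analysis.ODE.stronglyMeasurable_forcedSolution (mΩ := mΩ) (G := fun w => forcing (X w) (G w)) hK
      (fun w => continuous_forcing (X w) (hGc w)) (fun r => ?_) t
    · exact h.measurable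
    · exact (hX.add (measurable_const.prodMk (hGm r))).stronglyMeasurable
  refine measurable_of_tendsto_metrizable hn ?_
  rw [tendsto_pi_nhds]
  intro w
  -- the sequence is eventually constant, equal to the flow
  rcases le_or_gt t 0 with ht | ht
  · have hc : ∀ n : ℕ, (pureQuarticChain μ γ).truncSol N (n + 1) (X w) (G w) t =
        X w + ((0 : Fin N → ℝ), G w 0) := by
      intro n
      obtain ⟨K, hK⟩ := pureQuarticChain_exists_lipschitzWith_truncDrift μ γ N
        (by positivity : (0 : ℝ) < n + 1)
      unfold OscillatorChain.truncSol
      rw [Literature.Analysis.ODE.forcedSolution_of_nonpos _ _ ht, Literature.Analysis.ODE.forcedSolution_zero hK (continuous_forcing _ (hGc w))]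
      rfl
    rw [pureQuarticChain_chainFlow_of_nonpos μ γ N (X w) (hGc w) ht]
    simp only [hc]
    exact tendsto_const_nhds
  · obtain ⟨M, -, hM⟩ := exists_noiseBound (hGc w) t
    set R := pureQuarticRadius μ γ N ((pureQuarticChain μ γ).hamiltonian N (X w)) M t
    obtain ⟨n₀, hn₀⟩ := exists_nat_ge R
    refine tendsto_const_nhds.congr' ?_
    filter_upwards [eventually_ge_atTop n₀] with n hn
    have hnR : R ≤ (n : ℝ) + 1 := hn₀.trans (by exact_mod_cast Nat.le_succ_of_le hn)
    exact pureQuarticChain_chainFlow_eqOn_truncSol hμ hγ N (by positivity) (X w) (hGc w) hM hnR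
      ⟨ht.le, le_rfl⟩

end PureQuarticFlow

end Literature.MathematicalPhysics.KineticTheory.HeatConduction
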